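import Summits.HubbardSuperconductivity.HubbardSuperconductivity.Theorems.AnisotropyChordTransferFibre3RowCLamIncrLattice
import Summits.HubbardSuperconductivity.HubbardSuperconductivity.Theorems.AnisotropyChordTransferFibre3KT2bRow
import Summits.HubbardSuperconductivity.HubbardSuperconductivity.Theorems.AnisotropyChordTransferFibre3LamPart
import Summits.HubbardSuperconductivity.HubbardSuperconductivity.Theorems.AnisotropyChordTransferFibre3ShellWeight
import Summits.HubbardSuperconductivity.HubbardSuperconductivity.Theorems.AnisotropyChordTransferFibre3RingResolvent
import Summits.HubbardSuperconductivity.HubbardSuperconductivity.Theorems.AnisotropyChordTransferFibre3DiagRotation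

/-!
# Route `AnisotropyChord` / H0 rotor rung: PartN41-C §4 — `LamIncrementBound` PROVED (`|δ_λ(b) − δ_λ(b − e)| ≤ 0.001`, `L ≥ 128`)

Theory-1 g22's PartN41-C §4 `LamIncrementBound` (port …Fibre3KT2bRow): for `L ≥ 128`, `0 ≤ λ₂ ≤ 0.0513θ²`, `e` a nearest
neighbour and every `b`, `|δ_λ(b) − δ_λ(b − e)| ≤ 0.001`.  Proof: by the resolvent difference identity (`lamPartIdentity_holds`)
`δ_λ(b) − δ_λ(b−e) = (λ/V)Σ_{k≠0}[cos k·(b−e) − cos k·b]/(2ε(2ε−λ))`; the cosine difference is at most the centred angle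
`θ|m_e(k)|` of `k·e` (`|cos u − cos v| ≤ |u − v|`, ★ `abs_re_phase_shift_sub_le`), a coordinate of the centred representative
`m(k)`; `ε(k) ≥ cθ²|m|²` with `c = 0.47` when `|m|∞ ≤ L/8` (★ `one_sub_cos_ge_inner`: `1 − cos x ≥ 0.47x²` on `|x| ≤ π/4`) and
Jordan's `c = 0.2` beyond, so each term is `≤ g(m)/(2θ³)` with the lattice weight of …RowCLamIncrLattice, whose box sum is `≤ 28`;
hence the increment is `≤ (λ/V)·14/θ³ ≤ 7κ/(πL) ≤ 8.94·10⁻⁴`.  ★ `RowC.lam_increment_bound`, ★ `lamIncrementBound_holds :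
LamIncrementBound`.
Prover seat `hubbard-h0-rotor-p1` g27 (route lead); helper for stmt-HubbardSuperconductivity-23918 (`--supports`, helper class).
WHAT THIS IS NOT: nothing here proves superconductivity in the Hubbard model; one L-uniform constant of ONE row of ONE
conditional reduction.  Tree imports only; no new definitions; no sorry, no axioms.
-/

set_option linter.dupNamespace false
set_option autoImplicit false

noncomputable section

open scoped BigOperators

namespace Summit.HubbardSuperconductivity.HubbardSuperconductivity.Theorems.AnisotropyChord.Transfer.Fibre3

namespace RowC

open RateLemma

/-! ## §1 Trigonometric lower bound on the inner region -/

/-- `1 − cos x ≥ 0.47 x²` for `|x| ≤ π/4` (`sin y ≥ y − y³/6`). [folklore] -/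
theorem one_sub_cos_ge_inner (x : ℝ) (hx : |x| ≤ Real.pi / 4) : 0.47 * x ^ 2 ≤ 1 - Real.cos x := by
  have hπ := Real.pi_lt_d2
  -- reduce to `y = |x|/2 ∈ [0, π/8]`
  have hcos : Real.cos x = Real.cos |x| := by
    rcases abs_choice x with h | h
    · rw [h]
    · rw [h, Real.cos_neg]
  have hx2 : x ^ 2 = |x| ^ 2 := (sq_abs x).symm
  rw [hcos, hx2]
  set a := |x| with ha
  have ha0 : 0 ≤ a := abs_nonneg x
  have hy : 1 - Real.cos a = 2 * Real.sin (a / 2) ^ 2 := by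
    rw [Real.sin_sq_eq_half_sub, show 2 * (a / 2) = a by ring]; ring
  rw [hy]
  set y := a / 2 with hydef
  have hy0 : 0 ≤ y := by positivity
  have hy4 : y ≤ 0.4 := by rw [hydef]; linarith
  have hs := Real.sin_ge_sub_cube hy0
  have hy2 : y ^ 2 ≤ 0.16 := by nlinarith
  have hpos : 0 ≤ y - y ^ 3 / 6 := by nlinarith
  have h2 : (y - y ^ 3 / 6) ^ 2 ≤ Real.sin y ^ 2 := pow_le_pow_left₀ hpos hs 2
  have h3 : (1 - y ^ 2 / 6) ^ 2 ≥ 1 - y ^ 2 / 3 := by nlinarith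
  have h4 : (y - y ^ 3 / 6) ^ 2 = y ^ 2 * (1 - y ^ 2 / 6) ^ 2 := by ring
  have h5 : 0.94 * y ^ 2 ≤ y ^ 2 * (1 - y ^ 2 / 6) ^ 2 := by
    have : y ^ 2 * (1 - y ^ 2 / 3) ≤ y ^ 2 * (1 - y ^ 2 / 6) ^ 2 := mul_le_mul_of_nonneg_left h3 (sq_nonneg y)
    nlinarith
  have ha2 : a ^ 2 = 4 * y ^ 2 := by rw [hydef]; ring
  rw [ha2]
  nlinarith

/-- inner region: `0.47θ²(m₁² + m₂²) ≤ ε(k)` when both centred representatives are `≤ L/8` in absolute value. [folklore] -/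
theorem epsT_ge_inner (L : ℕ) [NeZero L] (k : Tor L) (N₁ : ℕ) (hN₁ : 8 * N₁ ≤ L)
    (h1 : k.1.valMinAbs.natAbs ≤ N₁) (h2 : k.2.valMinAbs.natAbs ≤ N₁) :
    0.47 * (2 * Real.pi / L) ^ 2 * ((((k.1.valMinAbs : ℤ) : ℝ)) ^ 2 + (((k.2.valMinAbs : ℤ) : ℝ)) ^ 2) ≤ epsT L k := by
  have hL : (0 : ℝ) < L := by exact_mod_cast Nat.pos_of_ne_zero (NeZero.ne L)
  have hπ := Real.pi_pos
  rw [epsT_eq_wInt]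
  have key : ∀ m : ℤ, m.natAbs ≤ N₁ → 0.47 * (2 * Real.pi / L) ^ 2 * ((m : ℝ)) ^ 2 ≤ wInt L m := by
    intro m hm
    unfold wInt
    have e : 2 * Real.pi * (m : ℝ) / L = (2 * Real.pi / L) * m := by ring
    rw [e]
    have hb : |(2 * Real.pi / L) * (m : ℝ)| ≤ Real.pi / 4 := by
      rw [abs_mul, abs_of_pos (by positivity)]
      have hmR : |(m : ℝ)| ≤ N₁ := by
        rw [← Int.cast_abs, Int.abs_eq_natAbs]; exact_mod_cast hm
      have hN : (8 : ℝ) * N₁ ≤ L := by exact_mod_cast hN₁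
      calc 2 * Real.pi / L * |(m : ℝ)| ≤ 2 * Real.pi / L * N₁ := by
            exact mul_le_mul_of_nonneg_left hmR (by positivity)
        _ = Real.pi / 4 * (8 * N₁ / L) := by ring
        _ ≤ Real.pi / 4 * 1 := by
            apply mul_le_mul_of_nonneg_left _ (by positivity)
            rw [div_le_one hL]; exact hN
        _ = Real.pi / 4 := by ring
    have := one_sub_cos_ge_inner _ hb
    nlinarith
  have e1 := key _ h1
  have e2 := key _ h2
  nlinarith

/-- outer region (everywhere): `0.2θ²(m₁² + m₂²) ≤ ε(k)` (Jordan, `2/π² ≥ 0.2`). [folklore] -/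
theorem epsT_ge_outer (L : ℕ) [NeZero L] (k : Tor L) :
    0.2 * (2 * Real.pi / L) ^ 2 * ((((k.1.valMinAbs : ℤ) : ℝ)) ^ 2 + (((k.2.valMinAbs : ℤ) : ℝ)) ^ 2) ≤ epsT L k := by
  have hJ := jordanEpsLower_holds L k
  have hπ := Real.pi_lt_d2
  have hc : (0.2 : ℝ) ≤ 2 / Real.pi ^ 2 := by
    rw [le_div_iff₀ (by positivity)]; nlinarith [Real.pi_pos]
  have h0 : 0 ≤ (2 * Real.pi / L) ^ 2 * ((((k.1.valMinAbs : ℤ) : ℝ)) ^ 2 + (((k.2.valMinAbs : ℤ) : ℝ)) ^ 2) := by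
    positivity
  nlinarith

/-! ## §2 The termwise bound -/

/-- ★ termwise: `θ·s/((2ε)(2ε − λ)) ≤ (s/(c q (2cq − κ)))/(2θ³)` when `cθ²q ≤ ε`, `λ ≤ κθ²`, `q ≥ 1`, `c ≥ 0.2`. [folklore] -/
theorem term_le (θ s ε lam q c : ℝ) (hθ : 0 < θ) (hs : 0 ≤ s) (hc : 0.2 ≤ c) (hq : 1 ≤ q)
    (hEε : c * θ ^ 2 * q ≤ ε) (hl : lam ≤ 0.0513 * θ ^ 2) :
    θ * s / ((2 * ε) * (2 * ε - lam)) ≤ (s / (c * q * (2 * c * q - 0.0513))) / (2 * θ ^ 3) := by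
  have hθ2 : 0 < θ ^ 2 := by positivity
  have hκ : 0 < 2 * c * q - 0.0513 := by nlinarith
  have hD0 : 0 < c * q * (2 * c * q - 0.0513) := by
    have : 0 < c * q := by nlinarith
    positivity
  -- the model denominator
  have hEpos : 0 < 2 * (c * θ ^ 2 * q) := by
    have : 0 < c * q := by nlinarith
    positivity
  have hmod : (2 * (c * θ ^ 2 * q)) * (2 * (c * θ ^ 2 * q) - lam)
      ≤ (2 * ε) * (2 * ε - lam) := by
    have h1 : 2 * (c * θ ^ 2 * q) - lam ≤ 2 * ε - lam := by linarith
    have h2 : 0 ≤ 2 * (c * θ ^ 2 * q) - lam := by nlinarith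
    exact mul_le_mul (by linarith) h1 h2 (by linarith)
  have hmodpos : 0 < (2 * (c * θ ^ 2 * q)) * (2 * (c * θ ^ 2 * q) - lam) := by
    apply mul_pos hEpos; nlinarith
  have hden : 0 < (2 * ε) * (2 * ε - lam) := lt_of_lt_of_le hmodpos hmod
  -- compare with the model, then the model with the target
  calc θ * s / ((2 * ε) * (2 * ε - lam))
      ≤ θ * s / ((2 * (c * θ ^ 2 * q)) * (2 * (c * θ ^ 2 * q) - lam)) := by
        apply div_le_div_of_nonneg_left (by positivity) hmodpos hmod
    _ ≤ θ * s / ((2 * (c * θ ^ 2 * q)) * (2 * (c * θ ^ 2 * q) - 0.0513 * θ ^ 2)) := by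
        apply div_le_div_of_nonneg_left (by positivity) _ (by nlinarith)
        apply mul_pos hEpos; nlinarith
    _ = (s / (c * q * (2 * c * q - 0.0513))) / (2 * θ ^ 3) := by
        field_simp

/-! ## §3 The phase difference -/

/-- `Re φ_k(r) = cos(2π·val(k·r)/L)`. [folklore] -/
theorem re_phase_eq_cos (L : ℕ) [NeZero L] (k r : Tor L) :
    (phase L k r).re = Real.cos (2 * Real.pi * ((dotZ L k r).val : ℝ) / L) := by
  rw [phase_eq_phZ, phZ_re_eq_cos]

/-- ★ `|Re φ_k(b − e) − Re φ_k(b)| ≤ (2π/L)·|m(k·e)|` with `m` the centred representative. [folklore] -/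
theorem abs_re_phase_shift_sub_le (L : ℕ) [NeZero L] (k b e : Tor L) :
    |(phase L k (b - e)).re - (phase L k b).re|
      ≤ 2 * Real.pi / L * (((dotZ L k e).valMinAbs.natAbs : ℕ) : ℝ) := by
  have hL : (0 : ℝ) < L := by exact_mod_cast Nat.pos_of_ne_zero (NeZero.ne L)
  rw [re_phase_eq_cos, re_phase_eq_cos]
  -- `k·(b − e) = k·b − k·e`, read through an integer representative
  set u : ZMod L := dotZ L k b with hu
  set w : ZMod L := dotZ L k e with hw
  have hd : dotZ L k (b - e) = u - w := by
    rw [hu, hw]; unfold dotZ; simp only [Prod.fst_sub, Prod.snd_sub]; ring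
  set z : ℤ := (u.val : ℤ) - w.valMinAbs with hz
  have hz' : ((z : ZMod L)) = u - w := by
    simp [hz, ZMod.coe_valMinAbs]
  have h1 : Real.cos (2 * Real.pi * (((dotZ L k (b - e)).val : ℕ) : ℝ) / L)
      = Real.cos (2 * Real.pi * (z : ℝ) / L) := by
    rw [hd, ← hz', cos_two_pi_val_intCast]
  rw [h1, hz]
  push_cast
  have e : 2 * Real.pi * ((u.val : ℝ) - (w.valMinAbs : ℝ)) / L
      = 2 * Real.pi * (u.val : ℝ) / L - 2 * Real.pi / L * (w.valMinAbs : ℝ) := by ring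
  rw [e]
  refine (Real.abs_cos_sub_cos_le _ _).trans ?_
  rw [show 2 * Real.pi * (u.val : ℝ) / L - 2 * Real.pi / L * (w.valMinAbs : ℝ) - 2 * Real.pi * (u.val : ℝ) / L
      = -(2 * Real.pi / L * (w.valMinAbs : ℝ)) by ring, abs_neg, abs_mul, abs_of_pos (by positivity)]
  apply mul_le_mul_of_nonneg_left _ (by positivity)
  rw [← Int.cast_natCast, Int.natCast_natAbs, Int.cast_abs]

/-- for a nearest neighbour `e`, `|m(k·e)|` is `|m₁(k)|` or `|m₂(k)|`. [folklore] -/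
theorem natAbs_dot_nn (L : ℕ) [NeZero L] (e : Tor L) (he : e ∈ nnList L) :
    ∃ i : Bool, ∀ k : Tor L, (dotZ L k e).valMinAbs.natAbs = (if i then k.1 else k.2).valMinAbs.natAbs := by
  simp only [nnList, List.mem_cons, List.mem_nil_iff, or_false] at he
  rcases he with h | h | h | h
  · refine ⟨true, fun k => ?_⟩; rw [h]; unfold dotZ; simp
  · refine ⟨true, fun k => ?_⟩
    rw [h]; unfold dotZ
    simp only [mul_neg, mul_one, mul_zero, add_zero, if_true]
    exact ZMod.natAbs_valMinAbs_neg k.1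
  · refine ⟨false, fun k => ?_⟩; rw [h]; unfold dotZ; simp
  · refine ⟨false, fun k => ?_⟩
    rw [h]; unfold dotZ
    simp only [mul_neg, mul_one, mul_zero, zero_add, Bool.false_eq_true, if_false]
    exact ZMod.natAbs_valMinAbs_neg k.2

/-! ## §4 The torus sum dominated by the box sum -/

/-- ★ the torus sum of the termwise majorants is at most the box sum of the lattice weights (`L ≥ 128`, `N₁ = L/8`). [folklore] -/
theorem torus_sum_le_box (L : ℕ) [NeZero L] (hL : 128 ≤ L) (lam2 : ℝ)
    (hl : lam2 ≤ 0.0513 * (2 * Real.pi / L) ^ 2) (i : Bool) :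
    (∑ k : Tor L, if k = 0 then (0 : ℝ)
        else (2 * Real.pi / L) * (((if i then k.1 else k.2).valMinAbs.natAbs : ℕ) : ℝ)
          / ((2 * epsT L k) * (2 * epsT L k - lam2)))
      ≤ 28 / (2 * (2 * Real.pi / L) ^ 3) := by
  set θ : ℝ := 2 * Real.pi / L with hθ
  have hLpos : (0 : ℝ) < L := by exact_mod_cast (show 0 < L by omega)
  have hθpos : 0 < θ := by positivity
  set N₁ : ℕ := L / 8 with hN₁
  set N : ℕ := L / 2 with hN
  have hN₁16 : 16 ≤ N₁ := by omega
  have hN₁N : N₁ ≤ N := by omega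
  have h8 : 8 * N₁ ≤ L := by omega
  -- the lattice weight
  set g : ℤ × ℤ → ℝ := fun m => ((if i then m.1 else m.2).natAbs : ℝ)
          / ((if m.1.natAbs ≤ N₁ ∧ m.2.natAbs ≤ N₁ then (0.47 : ℝ) else 0.2)
              * (((m.1 ^ 2 + m.2 ^ 2 : ℤ)) : ℝ)
              * (2 * (if m.1.natAbs ≤ N₁ ∧ m.2.natAbs ≤ N₁ then (0.47 : ℝ) else 0.2)
                  * (((m.1 ^ 2 + m.2 ^ 2 : ℤ)) : ℝ) - 0.0513)) with hg
  have hbox : ∑ m ∈ puncturedBox N, g m ≤ 28 := box_weight_sum_le N₁ N hN₁16 hN₁N i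
  have hg0 : ∀ m : ℤ × ℤ, 0 ≤ g m := by
    intro m
    rw [hg]; simp only
    by_cases hm : m = (0, 0)
    · rw [hm]; simp
    · apply div_nonneg (by positivity)
      have hq : (1 : ℝ) ≤ (((m.1 ^ 2 + m.2 ^ 2 : ℤ)) : ℝ) := by
        have : (1 : ℤ) ≤ m.1 ^ 2 + m.2 ^ 2 := by
          have : m.1 ≠ 0 ∨ m.2 ≠ 0 := by
            by_contra h; push Not at h; exact hm (Prod.ext h.1 h.2)
          rcases this with h | h
          · have := Int.one_le_abs h; nlinarith [abs_nonneg m.1, sq_abs m.1, sq_nonneg m.2]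
          · have := Int.one_le_abs h; nlinarith [abs_nonneg m.2, sq_abs m.2, sq_nonneg m.1]
        exact_mod_cast this
      have hc : (0.2 : ℝ) ≤ (if m.1.natAbs ≤ N₁ ∧ m.2.natAbs ≤ N₁ then (0.47 : ℝ) else 0.2) := by
        split_ifs <;> norm_num
      have : 0 < (if m.1.natAbs ≤ N₁ ∧ m.2.natAbs ≤ N₁ then (0.47 : ℝ) else 0.2)
          * (((m.1 ^ 2 + m.2 ^ 2 : ℤ)) : ℝ) := by nlinarith
      have : 0 < 2 * (if m.1.natAbs ≤ N₁ ∧ m.2.natAbs ≤ N₁ then (0.47 : ℝ) else 0.2)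
          * (((m.1 ^ 2 + m.2 ^ 2 : ℤ)) : ℝ) - 0.0513 := by nlinarith
      positivity
  -- termwise domination by `g(rep k)/(2θ³)`
  have hterm : ∀ k : Tor L, (if k = 0 then (0 : ℝ)
      else θ * (((if i then k.1 else k.2).valMinAbs.natAbs : ℕ) : ℝ) / ((2 * epsT L k) * (2 * epsT L k - lam2)))
      ≤ g (k.1.valMinAbs, k.2.valMinAbs) / (2 * θ ^ 3) := by
    intro k
    by_cases hk : k = 0
    · rw [if_pos hk]; exact div_nonneg (hg0 _) (by positivity)
    · rw [if_neg hk]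
      -- `q = |m|² ≥ 1`
      have hq : (1 : ℝ) ≤ ((((k.1.valMinAbs) ^ 2 + (k.2.valMinAbs) ^ 2 : ℤ)) : ℝ) := by
        have : k.1.valMinAbs ≠ 0 ∨ k.2.valMinAbs ≠ 0 := by
          by_contra hcon
          push Not at hcon
          apply hk
          ext
          · simpa using (ZMod.valMinAbs_eq_zero k.1).1 hcon.1
          · simpa using (ZMod.valMinAbs_eq_zero k.2).1 hcon.2
        have h1 : (1 : ℤ) ≤ k.1.valMinAbs ^ 2 + k.2.valMinAbs ^ 2 := by
          rcases this with h | h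
          · have := Int.one_le_abs h
            nlinarith [abs_nonneg k.1.valMinAbs, sq_abs k.1.valMinAbs, sq_nonneg k.2.valMinAbs]
          · have := Int.one_le_abs h
            nlinarith [abs_nonneg k.2.valMinAbs, sq_abs k.2.valMinAbs, sq_nonneg k.1.valMinAbs]
        exact_mod_cast h1
      have hqe : ((((k.1.valMinAbs) ^ 2 + (k.2.valMinAbs) ^ 2 : ℤ)) : ℝ)
          = (((k.1.valMinAbs : ℤ) : ℝ)) ^ 2 + (((k.2.valMinAbs : ℤ) : ℝ)) ^ 2 := by push_cast; ring
      have hsel : (((if i then ((k.1.valMinAbs, k.2.valMinAbs) : ℤ × ℤ).1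
            else ((k.1.valMinAbs, k.2.valMinAbs) : ℤ × ℤ).2).natAbs : ℕ) : ℝ)
          = (((if i then k.1 else k.2).valMinAbs.natAbs : ℕ) : ℝ) := by cases i <;> rfl
      rw [hg]; simp only []
      rw [hsel]
      by_cases hin : k.1.valMinAbs.natAbs ≤ N₁ ∧ k.2.valMinAbs.natAbs ≤ N₁
      · rw [if_pos hin]
        have hE := epsT_ge_inner L k N₁ h8 hin.1 hin.2
        rw [← hqe] at hE
        exact term_le θ _ (epsT L k) lam2 _ 0.47 hθpos (by positivity) (by norm_num) hq
          (by linarith) hl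
      · rw [if_neg hin]
        have hE := epsT_ge_outer L k
        rw [← hqe] at hE
        exact term_le θ _ (epsT L k) lam2 _ 0.2 hθpos (by positivity) le_rfl hq
          (by linarith) hl
  -- sum over the torus ≤ sum of `g ∘ rep` ≤ box sum
  have s1 : (∑ k : Tor L, if k = 0 then (0 : ℝ)
        else θ * (((if i then k.1 else k.2).valMinAbs.natAbs : ℕ) : ℝ) / ((2 * epsT L k) * (2 * epsT L k - lam2)))
      ≤ ∑ k : Tor L, g (k.1.valMinAbs, k.2.valMinAbs) / (2 * θ ^ 3) :=
    Finset.sum_le_sum fun k _ => hterm k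
  refine s1.trans ?_
  rw [← Finset.sum_div]
  apply div_le_div_of_nonneg_right _ (by positivity)
  -- `Σ_k g(rep k) ≤ Σ_{box} g = Σ_{pbox N} g`
  have s2 : (∑ k : Tor L, g (k.1.valMinAbs, k.2.valMinAbs))
      = ∑ m ∈ (Finset.univ : Finset (Tor L)).image (fun k : Tor L => (k.1.valMinAbs, k.2.valMinAbs)), g m := by
    rw [Finset.sum_image (fun a _ b _ h => rep_injective L h)]
  set box : Finset (ℤ × ℤ) := (Finset.Icc (-(N : ℤ)) N) ×ˢ (Finset.Icc (-(N : ℤ)) N) with hboxdef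
  have s3 : (Finset.univ : Finset (Tor L)).image (fun k : Tor L => (k.1.valMinAbs, k.2.valMinAbs)) ⊆ box := by
    rw [Finset.image_subset_iff]
    intro k _
    rw [hboxdef, hN]
    exact rep_mem_box L k
  have s4 := Finset.sum_le_sum_of_subset_of_nonneg s3 (fun m _ _ => hg0 m)
  have h0mem : ((0 : ℤ), (0 : ℤ)) ∈ box := by rw [hboxdef]; simp
  have s5 : (∑ m ∈ box, g m) = ∑ m ∈ puncturedBox N, g m := by
    have hpb : puncturedBox N = box.erase ((0 : ℤ), (0 : ℤ)) := rfl
    rw [hpb, ← Finset.sum_erase_add box _ h0mem]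
    have hz : g ((0 : ℤ), (0 : ℤ)) = 0 := by rw [hg]; simp
    rw [hz, add_zero]
  calc (∑ k : Tor L, g (k.1.valMinAbs, k.2.valMinAbs)) = _ := s2
    _ ≤ ∑ m ∈ box, g m := s4
    _ = ∑ m ∈ puncturedBox N, g m := s5
    _ ≤ 28 := hbox

/-! ## §5 `LamIncrementBound` -/

/-- ★ `|δ_λ(b) − δ_λ(b − e)| ≤ 0.001` (`L ≥ 128`, `0 ≤ λ₂ ≤ 0.0513θ²`, `e` a nearest neighbour). [folklore] -/
theorem lam_increment_bound (L : ℕ) [NeZero L] (hL : 128 ≤ L) {lam2 : ℝ} (hl0 : 0 ≤ lam2)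
    (hl : lam2 ≤ 0.0513 * (2 * Real.pi / L) ^ 2) {e : Tor L} (he : e ∈ nnList L) (b : Tor L) :
    |lamPart L lam2 b - lamPart L lam2 (b - e)| ≤ 0.001 := by
  have hLpos : (0 : ℝ) < L := by exact_mod_cast (show 0 < L by omega)
  have hL128 : (128 : ℝ) ≤ L := by exact_mod_cast hL
  set θ : ℝ := 2 * Real.pi / L with hθ
  have hθpos : 0 < θ := by positivity
  have hV : (0 : ℝ) < (L : ℝ) ^ 2 := by positivity
  -- `λ < 2ε₁`
  have hεJ : 2 / Real.pi ^ 2 * θ ^ 2 ≤ eps1 L := eps1_ge_jordan L (by omega)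
  have hπ := Real.pi_lt_d2
  have hπ0 := Real.pi_pos
  have hl2 : lam2 < 2 * eps1 L := by
    have : 0.0513 * θ ^ 2 < 2 * (2 / Real.pi ^ 2 * θ ^ 2) := by
      have hθ2 : 0 < θ ^ 2 := by positivity
      have h4 : (0.0513 : ℝ) < 4 / Real.pi ^ 2 := by
        rw [lt_div_iff₀ (by positivity)]; nlinarith
      have := mul_lt_mul_of_pos_right h4 hθ2
      have e : 4 / Real.pi ^ 2 * θ ^ 2 = 2 * (2 / Real.pi ^ 2 * θ ^ 2) := by ring
      linarith
    linarith
  -- the difference identity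
  have hid := lamPartIdentity_holds L lam2 hl0 hl2
  obtain ⟨i, hi⟩ := natAbs_dot_nn L e he
  -- positivity of the denominators
  have hden : ∀ k : Tor L, k ≠ 0 → 0 < (2 * epsT L k) * (2 * epsT L k - lam2) := by
    intro k hk
    have hε : eps1 L ≤ epsT L k := eps1_le_epsT L (by omega) hk
    apply mul_pos <;> nlinarith [Real.pi_pos]
  -- termwise: `|Δ_k| ≤ θ|m_i(k)|/den`
  have hdiff : lamPart L lam2 b - lamPart L lam2 (b - e)
      = lam2 * (∑ k : Tor L, if k = 0 then (0 : ℝ)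
          else ((phase L k (b - e)).re - (phase L k b).re) / ((2 * epsT L k) * (2 * epsT L k - lam2))) / (L : ℝ) ^ 2 := by
    rw [hid b, hid (b - e)]
    unfold lamPartSum
    rw [← sub_div, ← mul_sub, ← Finset.sum_sub_distrib]
    congr 2
    refine Finset.sum_congr rfl fun k _ => ?_
    split_ifs <;> ring
  have habs : |lamPart L lam2 b - lamPart L lam2 (b - e)|
      ≤ lam2 * (∑ k : Tor L, if k = 0 then (0 : ℝ)
          else θ * (((if i then k.1 else k.2).valMinAbs.natAbs : ℕ) : ℝ)
            / ((2 * epsT L k) * (2 * epsT L k - lam2))) / (L : ℝ) ^ 2 := by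
    rw [hdiff, abs_div, abs_mul, abs_of_nonneg hl0, abs_of_pos hV]
    apply div_le_div_of_nonneg_right _ hV.le
    apply mul_le_mul_of_nonneg_left _ hl0
    refine (Finset.abs_sum_le_sum_abs _ _).trans (Finset.sum_le_sum fun k _ => ?_)
    by_cases hk : k = 0
    · rw [if_pos hk, if_pos hk, abs_zero]
    · rw [if_neg hk, if_neg hk, abs_div, abs_of_pos (hden k hk)]
      apply div_le_div_of_nonneg_right _ (hden k hk).le
      rw [← hi k]
      exact abs_re_phase_shift_sub_le L k b e
  have hbox := torus_sum_le_box L hL lam2 hl i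
  -- assemble: `λ · (28/(2θ³)) / V ≤ 0.001`
  have hsum0 : 0 ≤ ∑ k : Tor L, (if k = 0 then (0 : ℝ)
      else θ * (((if i then k.1 else k.2).valMinAbs.natAbs : ℕ) : ℝ) / ((2 * epsT L k) * (2 * epsT L k - lam2))) := by
    refine Finset.sum_nonneg fun k _ => ?_
    by_cases hk : k = 0
    · rw [if_pos hk]
    · rw [if_neg hk]; exact div_nonneg (by positivity) (hden k hk).le
  calc |lamPart L lam2 b - lamPart L lam2 (b - e)|
      ≤ lam2 * (∑ k : Tor L, if k = 0 then (0 : ℝ)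
          else θ * (((if i then k.1 else k.2).valMinAbs.natAbs : ℕ) : ℝ)
            / ((2 * epsT L k) * (2 * epsT L k - lam2))) / (L : ℝ) ^ 2 := habs
    _ ≤ (0.0513 * θ ^ 2) * (28 / (2 * θ ^ 3)) / (L : ℝ) ^ 2 := by
        apply div_le_div_of_nonneg_right _ hV.le
        exact mul_le_mul hl hbox hsum0 (by positivity)
    _ = 0.0513 * 7 / (Real.pi * L) := by
        rw [hθ]; field_simp; ring
    _ ≤ 0.001 := by
        rw [div_le_iff₀ (by positivity)]
        nlinarith [Real.pi_gt_three]

end RowC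

/-- ★ **`LamIncrementBound` holds.** [folklore] -/
theorem lamIncrementBound_holds : LamIncrementBound := by
  intro L _ hL lam2 hl0 hl e he b
  exact RowC.lam_increment_bound L hL hl0 hl he b

end Summit.HubbardSuperconductivity.HubbardSuperconductivity.Theorems.AnisotropyChord.Transfer.Fibre3

end
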